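import HarnessLib
import Summits.CriticalPhenomena.Ising3DConformalLimit.Theorems.HyperoctahedralRPTwoPointKernelOfLimitClauses

/-!
# Vague asymptotic isotropy of the critical `ℤ³` two-point function, X:
# arity-local symmetries and continuity of a partial pointwise scaling limit
(route HarmonicMomentsIsotropy, support item stmt-CriticalPhenomena-6036 `TwoPointAsymptoticIsotropy`;
first file of the PAIR-ONLY conditional line)

The tree's structural theorems about pointwise scaling limits of the critical `ℤ³` Ising correlators —
translation invariance (`limit_translate`), continuity off the diagonals (`limit_continuousOn`),
invariance under coordinate permutations (`limit_coordPerm`) and sign flips (`limit_signFlip`), hence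
under all signed permutations (`limit_signedPerm`) — are stated for a FULL pointwise scaling limit
`HasPointwiseScalingLimit (criticalCorr 3) ρ S` (all arities at once), but each of their proofs uses the
convergence of ONE arity only. This file records the arity-local forms: the hypothesis is the locally
uniform convergence of the rescaled `n`-point correlator alone,
`TendstoLocallyUniformlyOn (rescaledCorrelator (criticalCorr 3) ρ n) Sₙ (𝓝[>] 0) (NonCoincident 3 n)`,
for ONE `n` and ONE function `Sₙ` (any renormalisation `ρ`, no other hypothesis):

* `limit_translate_arity` — `Sₙ(x + v) = Sₙ(x)` on `NonCoincident` (lattice translation invariance of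
  the plus state, axis translations along the meshes `t/(k+1)`);
* `limit_continuousOn_arity` — `Sₙ` is continuous on `NonCoincident 3 n` (cellmate shifts + translation
  invariance);
* `limit_coordPerm_arity`, `limit_signFlip_arity`, `limit_signedPerm_arity` — invariance under the
  hyperoctahedral group `B₃` acting diagonally.

The proofs are those of the tree files `…MoebiusLimitExists/Negative/FreeTranslations`,
`…RotationUpgradeFromTwoPoint/Negative/ContinuityFree`, `…MoebiusLimitExists/Negative/FreePermutations`,
`…/FreeReflections` and `…HyperoctahedralRPTwoPointKernelOfLimitClauses` with `hlim n` replaced by the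
arity-local hypothesis; they are needed at `n = 2` by the pair-only conditional line
(`twoPointAsymptoticIsotropy_of_pairLimit`), where no limit of the higher correlators is available.

References: S. Friedli, Y. Velenik, *Statistical Mechanics of Lattice Systems* (CUP 2017), Thm. 3.17
and Exercise 3.14 [FriedliVelenik2017]. No definitions are introduced.
-/

noncomputable section

namespace Summit.CriticalPhenomena.Ising3DConformalLimit.HarmonicMomentsIsotropyTwoPoint

open Literature.Probability.LatticeModels Filter Set
open scoped Topology
open Summit.CriticalPhenomena.Ising3DConformalLimit.MoebiusLimitExistsNegative
open Summit.CriticalPhenomena.Ising3DConformalLimit.RotationUpgradeFromTwoPointNegative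
open Summit.CriticalPhenomena.Ising3DConformalLimit.HyperoctahedralRPTwoPoint

variable {ρ : ℝ → ℝ} {n : ℕ} {Sn : (Fin n → EuclideanSpace ℝ (Fin 3)) → ℝ}

/-! ### Translation invariance of a one-arity limit -/

/-- Translation by `t·m̂`, `t > 0`, `m ∈ ℤ³`: `Sₙ(x + t m̂) = Sₙ(x)` on `NonCoincident`, for a limit of
the `n`-point correlators alone. [cite: FriedliVelenik2017, Thm. 3.17] -/
theorem limit_translate_pos_arity
    (hlim : TendstoLocallyUniformlyOn (rescaledCorrelator (criticalCorr 3) ρ n) Sn (𝓝[>] (0:ℝ))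
      (NonCoincident 3 n))
    {x : Fin n → EuclideanSpace ℝ (Fin 3)} (hx : x ∈ NonCoincident 3 n) (m : Site 3) {t : ℝ}
    (ht : 0 < t) :
    Sn (fun i => x i + t • siteVec m) = Sn x := by
  have hxv : (fun i => x i + t • siteVec m) ∈ NonCoincident 3 n := (add_mem_nonCoincident_iff _ x).2 hx
  have h1 := (hlim.tendsto_at hxv).comp (tendsto_div_succ_nhdsGT ht)
  have h2 := (hlim.tendsto_at hx).comp (tendsto_div_succ_nhdsGT ht)
  refine tendsto_nhds_unique h1 (h2.congr fun k => ?_)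
  simp only [Function.comp_apply]
  rw [rescaledCorrelator_apply, rescaledCorrelator_apply]
  congr 1
  have hδ : 0 < t / ((k:ℝ) + 1) := by positivity
  have hcfg : (fun i => latticeApprox (t / ((k:ℝ) + 1)) (x i + t • siteVec m)) =
      fun i => latticeApprox (t / ((k:ℝ) + 1)) (x i) + ((k + 1 : ℕ) : ℤ) • m := by
    funext i
    have h := latticeApprox_add_natMul_smul hδ (x i) m (k + 1)
    have ht' : (((k + 1 : ℕ) : ℝ) * (t / ((k:ℝ) + 1))) = t := by
      push_cast
      field_simp
    rw [ht'] at h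
    exact h
  rw [hcfg]
  exact (criticalCorr_translate _ _).symm

/-- Translation by any real multiple of a lattice vector (one arity). [cite: FriedliVelenik2017, Thm. 3.17] -/
theorem limit_translate_smul_siteVec_arity
    (hlim : TendstoLocallyUniformlyOn (rescaledCorrelator (criticalCorr 3) ρ n) Sn (𝓝[>] (0:ℝ))
      (NonCoincident 3 n))
    {x : Fin n → EuclideanSpace ℝ (Fin 3)} (hx : x ∈ NonCoincident 3 n) (m : Site 3) (t : ℝ) :
    Sn (fun i => x i + t • siteVec m) = Sn x := by
  rcases lt_trichotomy t 0 with ht | rfl | ht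
  · have h : t • siteVec m = (-t) • siteVec (-m) := by
      ext j; simp [siteVec_apply]
    rw [h]
    exact limit_translate_pos_arity hlim hx (-m) (by linarith)
  · simp
  · exact limit_translate_pos_arity hlim hx m ht

/-- **A pointwise limit of the critical `n`-point correlators on `ℤ³` (one arity, any
renormalisation) is translation invariant on non-coincident configurations.**
[cite: FriedliVelenik2017, Thm. 3.17] -/
theorem limit_translate_arity
    (hlim : TendstoLocallyUniformlyOn (rescaledCorrelator (criticalCorr 3) ρ n) Sn (𝓝[>] (0:ℝ))
      (NonCoincident 3 n))
    (v : EuclideanSpace ℝ (Fin 3)) {x : Fin n → EuclideanSpace ℝ (Fin 3)}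
    (hx : x ∈ NonCoincident 3 n) :
    Sn (fun i => x i + v) = Sn x := by
  set a : EuclideanSpace ℝ (Fin 3) := v 0 • siteVec (Pi.single 0 1 : Site 3) with ha
  set b : EuclideanSpace ℝ (Fin 3) := v 1 • siteVec (Pi.single 1 1 : Site 3) with hb
  set c : EuclideanSpace ℝ (Fin 3) := v 2 • siteVec (Pi.single 2 1 : Site 3) with hc
  have hv : v = a + b + c := by
    ext j
    fin_cases j <;> simp [ha, hb, hc, siteVec_apply]
  have hxa : (fun i => x i + a) ∈ NonCoincident 3 n := (add_mem_nonCoincident_iff _ _).2 hx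
  have hxab : (fun i => (x i + a) + b) ∈ NonCoincident 3 n := (add_mem_nonCoincident_iff _ _).2 hxa
  have hcfg : (fun i => x i + v) = fun i => ((x i + a) + b) + c := by
    funext i; rw [hv]; abel
  rw [hcfg, limit_translate_smul_siteVec_arity hlim hxab _ _,
    limit_translate_smul_siteVec_arity hlim hxa _ _, limit_translate_smul_siteVec_arity hlim hx _ _]

/-! ### Continuity of a one-arity limit -/

/-- **Continuity is free, arity by arity**: a pointwise limit `Sₙ` of the critical `n`-point
correlators on `ℤ³` (one arity, any `ρ`) is continuous on `NonCoincident 3 n` (cellmate shifts and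
`limit_translate_arity`). [cite: FriedliVelenik2017, Thm. 3.17] -/
theorem limit_continuousOn_arity
    (hlim : TendstoLocallyUniformlyOn (rescaledCorrelator (criticalCorr 3) ρ n) Sn (𝓝[>] (0:ℝ))
      (NonCoincident 3 n)) :
    ContinuousOn Sn (NonCoincident 3 n) := by
  intro x₀ hx₀
  rw [Metric.continuousWithinAt_iff]
  intro ε hε
  have hε3 : 0 < ε / 3 := by positivity
  have hU := hlim
  rw [Metric.tendstoLocallyUniformlyOn_iff] at hU
  obtain ⟨t, ht, hev⟩ := hU (ε / 3) hε3 x₀ hx₀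
  obtain ⟨r, hr, hsub⟩ := Metric.mem_nhdsWithin_iff.1 ht
  -- a mesh `δ < r/4` at which the uniform estimate holds on `t`
  have hr4 : (0 : ℝ) < r / 4 := by positivity
  obtain ⟨δ, hPδ, hδmem⟩ := (hev.and (Ioo_mem_nhdsGT hr4)).exists
  have hδ : 0 < δ := hδmem.1
  have hδr : δ < r / 4 := hδmem.2
  have hn1 : (0 : ℝ) < n + 1 := by positivity
  refine ⟨δ / (n + 1), by positivity, fun {y} hy hdist => ?_⟩
  -- coordinates of `y` and `x₀` are within `δ/(n+1)`
  have hcoord : ∀ i j, |x₀ i j - y i j| < δ / (n + 1) := by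
    intro i j
    have hi : dist (y i) (x₀ i) < δ / (n + 1) := (dist_pi_lt_iff (by positivity)).1 hdist i
    rw [dist_eq_norm] at hi
    calc |x₀ i j - y i j| = |(y i - x₀ i) j| := by
            rw [abs_sub_comm]; rfl
      _ ≤ ‖y i - x₀ i‖ := abs_apply_le_norm _ _
      _ < δ / (n + 1) := hi
  obtain ⟨w, hwnorm, hcell⟩ := exists_cellmate_shift hδ x₀ y hcoord
  -- the shifted configurations lie in `ball x₀ r ∩ NonCoincident`, hence in `t`
  have hδn : δ / (n + 1) ≤ δ := div_le_self hδ.le (by linarith)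
  have hx' : (fun i => x₀ i + w) ∈ t := by
    refine hsub ⟨?_, (add_mem_nonCoincident_iff w x₀).2 hx₀⟩
    rw [Metric.mem_ball]
    rcases Nat.eq_zero_or_pos n with hn | hn
    · subst hn
      have : (fun i : Fin 0 => x₀ i + w) = x₀ := funext fun i => i.elim0
      rw [this, dist_self]; exact hr
    · haveI : Nonempty (Fin n) := ⟨⟨0, hn⟩⟩
      refine (dist_pi_lt_iff hr).2 fun i => ?_
      rw [dist_eq_norm, add_sub_cancel_left]
      linarith
  have hy' : (fun i => y i + w) ∈ t := by
    refine hsub ⟨?_, (add_mem_nonCoincident_iff w y).2 hy⟩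
    rw [Metric.mem_ball]
    rcases Nat.eq_zero_or_pos n with hn | hn
    · subst hn
      have : (fun i : Fin 0 => y i + w) = x₀ := funext fun i => i.elim0
      rw [this, dist_self]; exact hr
    · haveI : Nonempty (Fin n) := ⟨⟨0, hn⟩⟩
      refine (dist_pi_lt_iff hr).2 fun i => ?_
      have hi : dist (y i) (x₀ i) < δ / (n + 1) := (dist_pi_lt_iff (by positivity)).1 hdist i
      calc dist (y i + w) (x₀ i) ≤ dist (y i + w) (y i) + dist (y i) (x₀ i) := dist_triangle _ _ _
        _ = ‖w‖ + dist (y i) (x₀ i) := by rw [dist_eq_norm, add_sub_cancel_left]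
        _ < r := by linarith
  -- assemble: `S y = S (y+w) ≈ F (y+w) = F (x₀+w) ≈ S (x₀+w) = S x₀`
  have h1 := hPδ _ hx'
  have h2 := hPδ _ hy'
  have hF : rescaledCorrelator (criticalCorr 3) ρ n δ (fun i => x₀ i + w) =
      rescaledCorrelator (criticalCorr 3) ρ n δ (fun i => y i + w) :=
    rescaledCorrelator_eq_of_cellmates _ _ δ hcell
  rw [limit_translate_arity hlim w hx₀] at h1
  rw [limit_translate_arity hlim w hy, ← hF] at h2
  rw [dist_comm] at h1
  calc dist (Sn y) (Sn x₀)
      ≤ dist (Sn y) (rescaledCorrelator (criticalCorr 3) ρ n δ fun i => x₀ i + w) +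
          dist (rescaledCorrelator (criticalCorr 3) ρ n δ fun i => x₀ i + w) (Sn x₀) :=
        dist_triangle _ _ _
    _ < ε / 3 + ε / 3 := add_lt_add h2 h1
    _ < ε := by linarith

/-! ### Hyperoctahedral invariance of a one-arity limit -/

/-- **A one-arity pointwise limit of the critical correlators on `ℤ³` is invariant under the
coordinate permutations of `ℝ³`** on non-coincident configurations.
[cite: FriedliVelenik2017, Exercise 3.14, p. 115] -/
theorem limit_coordPerm_arity
    (hlim : TendstoLocallyUniformlyOn (rescaledCorrelator (criticalCorr 3) ρ n) Sn (𝓝[>] (0:ℝ))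
      (NonCoincident 3 n))
    (π : Equiv.Perm (Fin 3)) {x : Fin n → EuclideanSpace ℝ (Fin 3)} (hx : x ∈ NonCoincident 3 n) :
    Sn (fun i => LinearIsometryEquiv.piLpCongrLeft 2 ℝ ℝ π (x i)) = Sn x := by
  have hRx := (map_mem_nonCoincident_iff (LinearIsometryEquiv.piLpCongrLeft 2 ℝ ℝ π) x).2 hx
  have h1 := hlim.tendsto_at hRx
  have h2 := hlim.tendsto_at hx
  exact tendsto_nhds_unique (h1.congr fun δ => rescaledCorrelator_coordPerm π n δ x) h2

/-- Sign-flip invariance of a one-arity limit at a GENERIC configuration (all coordinates irrational),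
along the meshes `1/(k+1)`. [cite: FriedliVelenik2017, Exercise 3.14, p. 115] -/
theorem limit_signFlip_of_irrational_arity
    (hlim : TendstoLocallyUniformlyOn (rescaledCorrelator (criticalCorr 3) ρ n) Sn (𝓝[>] (0:ℝ))
      (NonCoincident 3 n))
    (ε : Fin 3 → ℤˣ) (R : EuclideanSpace ℝ (Fin 3) ≃ₗᵢ[ℝ] EuclideanSpace ℝ (Fin 3))
    (hR : ∀ (p : EuclideanSpace ℝ (Fin 3)) (j : Fin 3), R p j = ((ε j : ℤ) : ℝ) * p j)
    {x : Fin n → EuclideanSpace ℝ (Fin 3)} (hx : x ∈ NonCoincident 3 n)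
    (hirr : ∀ i j, Irrational (x i j)) :
    Sn (fun i => R (x i)) = Sn x := by
  have hRx := (map_mem_nonCoincident_iff R x).2 hx
  have hmesh : Tendsto (fun k : ℕ => (1:ℝ) / ((k:ℝ) + 1)) atTop (𝓝[>] (0:ℝ)) :=
    tendsto_div_succ_nhdsGT one_pos
  have h1 := (hlim.tendsto_at hRx).comp hmesh
  have h2 := (hlim.tendsto_at hx).comp hmesh
  refine tendsto_nhds_unique h1 (h2.congr fun k => ?_)
  simp only [Function.comp_apply]
  rw [rescaledCorrelator_apply, rescaledCorrelator_apply]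
  congr 1
  have hcfg : (fun i => latticeApprox (1 / ((k:ℝ) + 1)) (R (x i))) =
      fun i => Site.signedPerm 1 ε (latticeApprox (1 / ((k:ℝ) + 1)) (x i)) +
        fun j => if ε j = -1 then -1 else 0 := by
    funext i; exact latticeApprox_signFlip ε R hR (hirr i) k
  rw [hcfg, criticalCorr_translate, criticalCorr_signedPerm]

/-- **A one-arity pointwise limit of the critical correlators on `ℤ³` is invariant under the
coordinate sign flips of `ℝ³`** on non-coincident configurations.
[cite: FriedliVelenik2017, Exercise 3.14, p. 115] -/
theorem limit_signFlip_arity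
    (hlim : TendstoLocallyUniformlyOn (rescaledCorrelator (criticalCorr 3) ρ n) Sn (𝓝[>] (0:ℝ))
      (NonCoincident 3 n))
    (ε : Fin 3 → ℤˣ) (R : EuclideanSpace ℝ (Fin 3) ≃ₗᵢ[ℝ] EuclideanSpace ℝ (Fin 3))
    (hR : ∀ (p : EuclideanSpace ℝ (Fin 3)) (j : Fin 3), R p j = ((ε j : ℤ) : ℝ) * p j)
    {x : Fin n → EuclideanSpace ℝ (Fin 3)} (hx : x ∈ NonCoincident 3 n) :
    Sn (fun i => R (x i)) = Sn x := by
  obtain ⟨w, hw⟩ := exists_translate_irrational x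
  have hxw : (fun i => x i + w) ∈ NonCoincident 3 n := (add_mem_nonCoincident_iff w x).2 hx
  have hRxw := (map_mem_nonCoincident_iff R (fun i => x i + w)).2 hxw
  -- `R (x i) = R (x i + w) + (-R w)`
  have hcfg : (fun i => R (x i)) = fun i => R (x i + w) + (-R w) := by
    funext i; rw [map_add]; abel
  rw [hcfg, limit_translate_arity hlim (-R w) hRxw,
    limit_signFlip_of_irrational_arity hlim ε R hR hxw hw, limit_translate_arity hlim w hx]

/-- A one-arity pointwise limit is invariant under every signed coordinate permutation of `ℝ³`
(`(R p)_j = ε_j p_{π⁻¹ j}`) on non-coincident configurations.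
[cite: FriedliVelenik2017, Exercise 3.14, p. 115] -/
theorem limit_signedPerm_arity
    (hlim : TendstoLocallyUniformlyOn (rescaledCorrelator (criticalCorr 3) ρ n) Sn (𝓝[>] (0:ℝ))
      (NonCoincident 3 n))
    (π : Equiv.Perm (Fin 3)) (ε : Fin 3 → ℤˣ)
    (R : EuclideanSpace ℝ (Fin 3) ≃ₗᵢ[ℝ] EuclideanSpace ℝ (Fin 3))
    (hR : ∀ (p : EuclideanSpace ℝ (Fin 3)) (j : Fin 3), R p j = ((ε j : ℤ) : ℝ) * p (π.symm j))
    {x : Fin n → EuclideanSpace ℝ (Fin 3)} (hx : x ∈ NonCoincident 3 n) :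
    Sn (fun i => R (x i)) = Sn x := by
  set P := LinearIsometryEquiv.piLpCongrLeft 2 ℝ ℝ π with hP
  set Rε : EuclideanSpace ℝ (Fin 3) ≃ₗᵢ[ℝ] EuclideanSpace ℝ (Fin 3) := P.symm.trans R with hRε
  have hPsymm : ∀ (p : EuclideanSpace ℝ (Fin 3)) (l : Fin 3), P.symm p l = p (π l) := by
    intro p l
    rw [hP, LinearIsometryEquiv.piLpCongrLeft_symm, coordPerm_apply]
    simp
  have hRε' : ∀ (p : EuclideanSpace ℝ (Fin 3)) (j : Fin 3), Rε p j = ((ε j : ℤ) : ℝ) * p j := by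
    intro p j
    rw [hRε, LinearIsometryEquiv.trans_apply, hR, hPsymm, Equiv.apply_symm_apply]
  have hPx := (map_mem_nonCoincident_iff P x).2 hx
  have h1 : (fun i => R (x i)) = fun i => Rε (P (x i)) := by
    funext i
    rw [hRε, LinearIsometryEquiv.trans_apply, LinearIsometryEquiv.symm_apply_apply]
  rw [h1, limit_signFlip_arity hlim ε Rε hRε' hPx, limit_coordPerm_arity hlim π hx]

end Summit.CriticalPhenomena.Ising3DConformalLimit.HarmonicMomentsIsotropyTwoPoint

end
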